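import Summits.CriticalPhenomena.PercolationContinuityZ3.Theorems.PercNearOneGluingNoHeavyQuantGatedSliceMixLawExchange
import Summits.CriticalPhenomena.PercolationContinuityZ3.Theorems.PercNearOneGluingNoHeavyQuantIncomeCriterion
import HarnessLib

/-!
# QUANT lane R8, T-DEC, leg (III), blob case — `LawDec.GatedSliceMixLaw'`, cell A5 (unsaturated mid), FIRST SUB-CELL: when the mid `k₂` of the
# moved law can absorb BOTH nonzero lows (the shifted low `k₁ + a` and `k₁`), the moved law is DEC by itself (offer form of the income criterion)

builds on p205010 (kernel theorem, internal audit signed; external expert review pending)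

Support file (`--supports stmt-CriticalPhenomena-4575`), QUANT lane typer seat prim-quant-stmt (gen 30), rung R8 of
`run/shared/lean/prim/quant/LADDER.md`.  Memo `run/shared/lean/prim/quant/prim-quant-stmt-g30/MIXLAW-MIXTURES-G30.md` §8 (i).  One theorem,
standard axioms, no sorries.  Tools: `movedTwoPoint_apply` (`…Exchange`), `flowAtT_of_offers` (arm-1 g39).

THE SUB-CELL (plan Π-B2 (i) of the memo).  `ℓ = k₁ + a` and `k₁ ≥ 1` are `t`-lows, `k₂ ≤ j` is a mid compatible with both, `k₂ + a` a giant, and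
`usage(ℓ,k₂)·m₁′ + usage(k₁,k₂)·m₁ ≤ m₂`.  Route both lows into `k₂`; the zero's offer inequality
`t·z ≤ (k₂ − t)⁺·(m₂ − loads) + t(1−y)/y·m₂′` follows from the mean identity `t·z = −(t−k₁)m₁ − (t−ℓ)m₁′ + (k₂−t)m₂ + (k₂+a−t)m₂′`,
`usage(i,k₂)(k₂ − t) ≤ t − i` (`usage_mid_mul_le`) and `y(k₂ + a) ≤ t`.  The complementary sub-cells of A5 (k₂ full; `k₁` incompatible with `k₂`)
are genuine mixtures (memo §8 (ii), (iii)).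

* **`LawDec.decAtT_movedTwoPoint_of_bothFit`**.

[this work]; income criterion: arm-1 g39.  The gluing rows served [cite: KozmaNitzan2024, Conjecture 3 (p. 15)]; product measure
[cite: Grimmett1999, §1.3 p. 10].
-/

noncomputable section

namespace Summit.CriticalPhenomena.PercolationContinuityZ3.Theorems

namespace Quant

open Finset

/-- the two-point law `{lo, hi; g}` (as in `…QuantLawDEC`) -/
local notation3 "TP[" lo ", " hi ", " g ", " h "]" =>
  (g : ℝ) * (if (h : ℕ) = (hi : ℕ) then (1 : ℝ) else 0) + (1 - (g : ℝ)) * (if (h : ℕ) = (lo : ℕ) then (1 : ℝ) else 0)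

namespace LawDec

set_option maxHeartbeats 800000 in
/-- **both nonzero lows fit into the mid `k₂` ⟹ the moved law is DEC** (frame of `GatedSliceMixLaw'` without `h`; `1 ≤ k₁`, `2(k₁+a) < t`,
`k₁ + a ≤ j`; `k₂ ≤ j`, `2k₂ ≥ t`, `t < k₁ + k₂`; `k₂ + a ≥ j+1`; `usage(k₁+a,k₂)·m₁′ + usage(k₁,k₂)·m₁ ≤ m₂`). [this work] -/
theorem decAtT_movedTwoPoint_of_bothFit (y z g S lam : ℝ) (a j M k₁ k₂ : ℕ)
    (hy0 : 0 < y) (hy1 : y < 1) (hz0 : 0 ≤ z) (hz1 : z < 1) (hg1 : g ≤ 1) (hyg : y ≤ (1 - z) * g)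
    (hta : y * (M : ℝ) ≤ S) (hk : k₁ ≤ k₂) (hk₂M : k₂ ≤ M) (hlam0 : 0 ≤ lam) (hlam1 : lam ≤ 1)
    (hmean : (1 - z) * ((k₁ : ℝ) + ((k₂ : ℝ) - k₁) * lam) = S)
    (hk₁ : 1 ≤ k₁) (hllow : 2 * ((k₁ + a : ℕ) : ℝ) < S + (a : ℝ) * g * (1 - z)) (hlj : k₁ + a ≤ j)
    (hk₂j : k₂ ≤ j) (hk₂mid : S + (a : ℝ) * g * (1 - z) ≤ 2 * (k₂ : ℝ)) (hcomp₁ : S + (a : ℝ) * g * (1 - z) < (k₁ : ℝ) + k₂)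
    (hk₂aG : j + 1 ≤ k₂ + a)
    (hfit : usage y (S + (a : ℝ) * g * (1 - z)) j (k₁ + a) k₂ * ((1 - z) * (1 - lam) * g)
      + usage y (S + (a : ℝ) * g * (1 - z)) j k₁ k₂ * ((1 - z) * (1 - lam) * (1 - g)) ≤ (1 - z) * lam * (1 - g)) :
    DECAtT y (S + (a : ℝ) * g * (1 - z)) j (M + a)
      (fun p => z * (if p = 0 then (1 : ℝ) else 0) + (1 - z) * slice (fun q => TP[k₁, k₂, lam, q]) a g p) := by
  classical
  set t : ℝ := S + (a : ℝ) * g * (1 - z) with ht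
  have h1z : 0 < 1 - z := by linarith
  have hg0 : 0 < g := by nlinarith
  have h1y : 0 < 1 - y := by linarith
  have ha0 : (0 : ℝ) ≤ a := Nat.cast_nonneg a
  have h1lam : 0 ≤ 1 - lam := by linarith
  have ht0 : 0 < t := by
    have : (0 : ℝ) ≤ ((k₁ + a : ℕ) : ℝ) := Nat.cast_nonneg _
    linarith
  have htaN : ∀ p : ℕ, p ≤ M + a → y * (p : ℝ) ≤ t := by
    intro p hp
    have : (p : ℝ) ≤ ((M + a : ℕ) : ℝ) := by exact_mod_cast hp
    push_cast at this; rw [ht]; nlinarith [mul_nonneg ha0 hg0.le]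
  set m₁ : ℝ := (1 - z) * (1 - lam) * (1 - g) with hm₁
  set m₁' : ℝ := (1 - z) * (1 - lam) * g with hm₁'
  set m₂ : ℝ := (1 - z) * lam * (1 - g) with hm₂
  set m₂' : ℝ := (1 - z) * lam * g with hm₂'
  have hm₁0 : 0 ≤ m₁ := mul_nonneg (mul_nonneg h1z.le h1lam) (by linarith)
  have hm₁'0 : 0 ≤ m₁' := mul_nonneg (mul_nonneg h1z.le h1lam) hg0.le
  have hm₂0 : 0 ≤ m₂ := mul_nonneg (mul_nonneg h1z.le hlam0) (by linarith)
  have hm₂'0 : 0 ≤ m₂' := mul_nonneg (mul_nonneg h1z.le hlam0) hg0.le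
  set Ul : ℝ := usage y t j (k₁ + a) k₂ with hUl
  set U₁ : ℝ := usage y t j k₁ k₂ with hU₁
  have hk1low : 2 * (k₁ : ℝ) < t := by push_cast at hllow; linarith
  have hcompl : t < ((k₁ + a : ℕ) : ℝ) + k₂ := by push_cast at hcomp₁ ⊢; linarith
  have hlk₂ : k₁ + a < k₂ := by
    have : ((k₁ + a : ℕ) : ℝ) < k₂ := by push_cast at hllow hcompl ⊢; linarith
    exact_mod_cast this
  have hk₁k₂ : k₁ < k₂ := by omega
  have hUl0 : 0 ≤ Ul := (usage_pos_of_compat y t j (k₁ + a) k₂ hy0 hy1 hllow hlk₂ (Or.inr hcompl)).le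
  have hU₁0 : 0 ≤ U₁ := (usage_pos_of_compat y t j k₁ k₂ hy0 hy1 hk1low hk₁k₂ (Or.inr hcomp₁)).le
  have hPnn : ∀ p, 0 ≤ z * (if p = 0 then (1 : ℝ) else 0) + (1 - z) * slice (fun q => TP[k₁, k₂, lam, q]) a g p := by
    intro p; rw [movedTwoPoint_apply, ← hm₁, ← hm₁', ← hm₂, ← hm₂']
    refine add_nonneg (add_nonneg (add_nonneg (add_nonneg (mul_nonneg hz0 ?_) (mul_nonneg hm₁0 ?_)) (mul_nonneg hm₁'0 ?_))
      (mul_nonneg hm₂0 ?_)) (mul_nonneg hm₂'0 ?_) <;> split_ifs <;> norm_num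
  -- the routing: both nonzero lows into k₂
  set φ : ℕ → ℕ → ℝ := fun l p => if p = k₂ then (if l = k₁ + a then m₁' else if l = k₁ then m₁ else 0) else 0 with hφ
  have hφ0 : ∀ l p, 0 ≤ φ l p := by
    intro l p; simp only [hφ]; split_ifs <;> first | exact hm₁'0 | exact hm₁0 | exact le_rfl
  -- mean identity and the offer inequality
  have hmeanid : t * z = -((t - k₁) * m₁) - (t - ((k₁ + a : ℕ) : ℝ)) * m₁' + ((k₂ : ℝ) - t) * m₂ + (((k₂ + a : ℕ) : ℝ) - t) * m₂' := by
    simp only [hm₁, hm₁', hm₂, hm₂']; push_cast; rw [ht]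
    have hS' : S = (1 - z) * ((k₁ : ℝ) + ((k₂ : ℝ) - k₁) * lam) := hmean.symm
    rw [hS']; ring
  have hsavel : Ul * m₁' * ((k₂ : ℝ) - t) ≤ (t - ((k₁ + a : ℕ) : ℝ)) * m₁' := by
    by_cases hkt : t < (k₂ : ℝ)
    · have hU := usage_mid_mul_le y t j (k₁ + a) k₂ hy0 hy1 hllow hk₂j hcompl (htaN k₂ (by omega))
      rw [← hUl] at hU
      calc Ul * m₁' * ((k₂ : ℝ) - t) = m₁' * (Ul * ((k₂ : ℝ) - t)) := by ring
        _ ≤ m₁' * (t - ((k₁ + a : ℕ) : ℝ)) := mul_le_mul_of_nonneg_left hU hm₁'0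
        _ = _ := by ring
    · have : Ul * m₁' * ((k₂ : ℝ) - t) ≤ 0 := mul_nonpos_of_nonneg_of_nonpos (mul_nonneg hUl0 hm₁'0) (by linarith)
      nlinarith [mul_nonneg hm₁'0 (show (0 : ℝ) ≤ t - ((k₁ + a : ℕ) : ℝ) by
        have : (0:ℝ) ≤ ((k₁ + a : ℕ) : ℝ) := Nat.cast_nonneg _; linarith)]
  have hsave₁ : U₁ * m₁ * ((k₂ : ℝ) - t) ≤ (t - k₁) * m₁ := by
    by_cases hkt : t < (k₂ : ℝ)
    · have hU := usage_mid_mul_le y t j k₁ k₂ hy0 hy1 hk1low hk₂j hcomp₁ (htaN k₂ (by omega))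
      rw [← hU₁] at hU
      calc U₁ * m₁ * ((k₂ : ℝ) - t) = m₁ * (U₁ * ((k₂ : ℝ) - t)) := by ring
        _ ≤ m₁ * (t - k₁) := mul_le_mul_of_nonneg_left hU hm₁0
        _ = _ := by ring
    · have : U₁ * m₁ * ((k₂ : ℝ) - t) ≤ 0 := mul_nonpos_of_nonneg_of_nonpos (mul_nonneg hU₁0 hm₁0) (by linarith)
      nlinarith [mul_nonneg hm₁0 (show (0 : ℝ) ≤ t - k₁ by linarith)]
  have hoff : t * z ≤ (if t < (k₂ : ℝ) then (k₂ : ℝ) - t else 0) * (m₂ - (Ul * m₁' + U₁ * m₁)) + t * (1 - y) / y * m₂' := by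
    have hg' : (((k₂ + a : ℕ) : ℝ) - t) * m₂' ≤ t * (1 - y) / y * m₂' := by
      refine mul_le_mul_of_nonneg_right ?_ hm₂'0
      rw [le_div_iff₀ hy0]; have := htaN (k₂ + a) (by omega); nlinarith
    rw [hmeanid]
    by_cases hkt : t < (k₂ : ℝ)
    · rw [if_pos hkt]
      have e : ((k₂ : ℝ) - t) * (m₂ - (Ul * m₁' + U₁ * m₁)) = ((k₂ : ℝ) - t) * m₂ - Ul * m₁' * ((k₂ : ℝ) - t) - U₁ * m₁ * ((k₂ : ℝ) - t) := by
        ring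
      rw [e]; linarith [hsavel, hsave₁, hg']
    · rw [if_neg hkt, zero_mul]
      have : ((k₂ : ℝ) - t) * m₂ ≤ 0 := mul_nonpos_of_nonpos_of_nonneg (by linarith) hm₂0
      have h1 : 0 ≤ (t - k₁) * m₁ := mul_nonneg (by linarith) hm₁0
      have h2 : 0 ≤ (t - ((k₁ + a : ℕ) : ℝ)) * m₁' := mul_nonneg (by have : (0:ℝ) ≤ ((k₁ + a : ℕ) : ℝ) := Nat.cast_nonneg _; linarith) hm₁'0
      linarith [hg']
  -- apply the offer form of the income criterion
  refine decAtT_of_flowAtT y t j (M + a) _ hy0 hy1 (fun p hp => movedTwoPoint_eq_zero z lam g a k₁ k₂ p hk (by omega))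
    (sum_movedTwoPoint z lam g a k₁ k₂ (M + a) hk (by omega)) ?_
  -- loads of k₂
  have hload : ∀ p, p = k₂ → ∑ l ∈ Finset.range (j + 1), usage y t j l p * φ l p = Ul * m₁' + U₁ * m₁ := by
    intro p hpk
    have e2 : ∀ l ∈ Finset.range (j + 1), usage y t j l p * φ l p
        = Ul * m₁' * (if l = k₁ + a then (1 : ℝ) else 0) + U₁ * m₁ * (if l = k₁ then (1 : ℝ) else 0) := by
      intro l _; simp only [hφ, if_pos hpk]
      by_cases hl1 : l = k₁ + a
      · rw [if_pos hl1, if_pos hl1, if_neg (show l ≠ k₁ by omega), hl1, hpk, hUl]; ring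
      · rw [if_neg hl1, if_neg hl1]
        by_cases hl2 : l = k₁
        · rw [if_pos hl2, if_pos hl2, hl2, hpk, hU₁]; ring
        · rw [if_neg hl2, if_neg hl2]; ring
    rw [Finset.sum_congr rfl e2, Finset.sum_add_distrib, sum_mul_indicator (fun _ => Ul * m₁') j (k₁ + a) hlj,
      sum_mul_indicator (fun _ => U₁ * m₁) j k₁ (by omega)]
  have hload0 : ∀ p, p ≠ k₂ → ∑ l ∈ Finset.range (j + 1), usage y t j l p * φ l p = 0 := by
    intro p hpk
    exact Finset.sum_eq_zero fun l _ => by simp only [hφ, if_neg hpk, mul_zero]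
  refine flowAtT_of_offers y t j (M + a) _ φ hy0 hy1 ht0 hPnn (fun p hpj hpM _ => htaN p hpM) hφ0 ?_ ?_ ?_ ?_
  · -- support of φ
    intro l p hp
    simp only [hφ] at hp
    by_cases hpk : p = k₂
    · rw [if_pos hpk] at hp
      by_cases hl1 : l = k₁ + a
      · rw [hl1, hpk]; exact ⟨⟨by omega, hlj, hllow⟩, by omega, Or.inr hcompl⟩
      · rw [if_neg hl1] at hp
        by_cases hl2 : l = k₁
        · rw [hl2, hpk]; exact ⟨⟨hk₁, by omega, hk1low⟩, by omega, Or.inr hcomp₁⟩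
        · rw [if_neg hl2] at hp; exact absurd hp (lt_irrefl 0)
    · rw [if_neg hpk] at hp; exact absurd hp (lt_irrefl 0)
  · -- rows: every nonzero low is shipped exactly
    intro l hl1 hlj' hlow
    have e : ∀ p ∈ Finset.range (M + a + 1), φ l p = (if l = k₁ + a then m₁' else if l = k₁ then m₁ else 0) * (if p = k₂ then (1 : ℝ) else 0) := by
      intro p _; simp only [hφ]; split_ifs <;> ring
    rw [Finset.sum_congr rfl e, sum_mul_indicator (fun _ => (if l = k₁ + a then m₁' else if l = k₁ then m₁ else 0)) (M + a) k₂ (by omega)]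
    rw [movedTwoPoint_apply, ← hm₁, ← hm₁', ← hm₂, ← hm₂', if_neg (show l ≠ 0 by omega), if_neg (show l ≠ k₂ + a by omega)]
    have hlk₂ : l ≠ k₂ := by intro h; subst h; linarith
    rw [if_neg hlk₂]
    by_cases hl1' : l = k₁ + a
    · rw [if_pos hl1', if_pos hl1', if_neg (show l ≠ k₁ by omega)]; ring
    · rw [if_neg hl1', if_neg hl1']
      by_cases hl2 : l = k₁
      · rw [if_pos hl2, if_pos hl2]; ring
      · rw [if_neg hl2, if_neg hl2]; ring
  · -- columns: only k₂ is loaded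
    intro p hpM _
    by_cases hpk : p = k₂
    · rw [hload p hpk, movedTwoPoint_apply, ← hm₁, ← hm₁', ← hm₂, ← hm₂', if_neg (show p ≠ 0 by omega), if_neg (show p ≠ k₁ by omega),
        if_neg (show p ≠ k₁ + a by omega), if_pos hpk, if_neg (show p ≠ k₂ + a by omega)]
      have hfit' : Ul * m₁' + U₁ * m₁ ≤ m₂ := by rw [hUl, hU₁]; linarith [hfit]
      linarith [hfit']
    · rw [hload0 p hpk]; exact hPnn p
  · -- the offer inequality
    have eA0 : (z * (if (0 : ℕ) = 0 then (1 : ℝ) else 0) + (1 - z) * slice (fun q => TP[k₁, k₂, lam, q]) a g 0) = z := by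
      rw [movedTwoPoint_apply, if_pos rfl, if_neg (show (0 : ℕ) ≠ k₁ by omega), if_neg (show (0 : ℕ) ≠ k₁ + a by omega),
        if_neg (show (0 : ℕ) ≠ k₂ by omega), if_neg (show (0 : ℕ) ≠ k₂ + a by omega)]; ring
    rw [eA0]
    have e : ∀ p ∈ Finset.range (M + a + 1),
        (if j + 1 ≤ p then t * (1 - y) / y else if t < (p : ℝ) then (p : ℝ) - t else 0)
          * ((z * (if p = 0 then (1 : ℝ) else 0) + (1 - z) * slice (fun q => TP[k₁, k₂, lam, q]) a g p)
            - ∑ l ∈ Finset.range (j + 1), usage y t j l p * φ l p)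
        = (if t < (k₂ : ℝ) then (k₂ : ℝ) - t else 0) * (m₂ - (Ul * m₁' + U₁ * m₁)) * (if p = k₂ then (1 : ℝ) else 0)
          + t * (1 - y) / y * m₂' * (if p = k₂ + a then (1 : ℝ) else 0) := by
      intro p _
      by_cases hpk : p = k₂
      · rw [hload p hpk, movedTwoPoint_apply, ← hm₁, ← hm₁', ← hm₂, ← hm₂', hpk, if_neg (show ¬ (j + 1 ≤ k₂) by omega),
          if_neg (show k₂ ≠ 0 by omega), if_neg (show k₂ ≠ k₁ by omega), if_neg (show k₂ ≠ k₁ + a by omega), if_pos (show k₂ = k₂ from rfl),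
          if_neg (show k₂ ≠ k₂ + a by omega)]
        ring
      · rw [hload0 p hpk, sub_zero, movedTwoPoint_apply, ← hm₁, ← hm₁', ← hm₂, ← hm₂', if_neg hpk]
        by_cases hpg : p = k₂ + a
        · rw [if_pos (show j + 1 ≤ p by omega), if_neg (show p ≠ 0 by omega), if_neg (show p ≠ k₁ by omega),
            if_neg (show p ≠ k₁ + a by omega), if_pos hpg]
          ring
        rw [if_neg hpg]
        by_cases hp0 : p = 0
        · rw [if_neg (show ¬ (j + 1 ≤ p) by omega), if_neg (show ¬ (t < (p : ℝ)) by rw [hp0]; push_cast; linarith)]; ring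
        by_cases hpl : p = k₁ + a
        · rw [if_neg (show ¬ (j + 1 ≤ p) by omega), if_neg (show ¬ (t < (p : ℝ)) by rw [hpl]; linarith)]; ring
        by_cases hp1 : p = k₁
        · rw [if_neg (show ¬ (j + 1 ≤ p) by omega), if_neg (show ¬ (t < (p : ℝ)) by rw [hp1]; linarith)]; ring
        rw [if_neg hp0, if_neg hp1, if_neg hpl]; ring
    rw [Finset.sum_congr rfl e, Finset.sum_add_distrib,
      sum_mul_indicator (fun _ => (if t < (k₂ : ℝ) then (k₂ : ℝ) - t else 0) * (m₂ - (Ul * m₁' + U₁ * m₁))) (M + a) k₂ (by omega),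
      sum_mul_indicator (fun _ => t * (1 - y) / y * m₂') (M + a) (k₂ + a) (by omega)]
    exact hoff

end LawDec

end Quant

end Summit.CriticalPhenomena.PercolationContinuityZ3.Theorems
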